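import Summits.BirchSwinnertonDyer.Rank1Residual.Additive.AdditiveFixedPointsFormalLevel
import HarnessLib

/-!
# `Γ_{ℚ_v}`-fixed points of `E(K̄_v)` at an ADDITIVE place `v ∋ p`: a bounded multiple lands in
# `E₁` of the minimal model, fixed torsion has bounded exponent, points `p`-divisible modulo torsion
# by fixed points for every `n` are torsion, and a fixed point of infinite order exists
# (row T-T3B FILE F4, part 1b = the three `Φ`-free exports of the level-calculus engine; cell `b2b-bsdres`, team n1011, seat p07
# (gen 9) for p12 GEN 8's row T-T3B; p12's frozen F4 signatures, cells/n1011/INBOX.md 19:50Z)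

HONEST FRAMING (cell `b2b-bsdres`, run/shared/lean/b2b/bsd-rank1-residual/, verbatim in every
file): the goal of the cell is to DELETE the COMBINATION-SHAPED residual classes of the
Birch–Swinnerton-Dyer formula for ALL analytic-rank `≤ 1` elliptic curves over `ℚ` — "full BSD
formula for every rank `≤ 1` curve in class `C`" assembled STRICTLY from published theorems — so
that the rank-`≤ 1` remainder becomes exactly the CONSTRUCTION-SHAPED classes, which are TYPED
(missing-input `Prop`s), NOT attempted. This is not "finishing BSD". Team n1011 (N10/N11): research
route on the CONSTRUCTION-SHAPED classes X3♯/X4♯(G-ord); TOOL theorems only: NO definition, NO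
named fact; closes nothing; census −0; nothing booked.

## What (row T-T3B = r2's T3b = p06's T-T3CTL F3 `𝒦_{v,0}[p^∞] = ⊥` at `v = p`; owner p12)

p12's F4 needs, for the `Γ_{ℚ_v}`-FIXED points of `E(K̄_v)`, finiteness of the fixed `p`-power
torsion (F4.d) and a fixed kernel point outside `p·(fixed kernel points) + (fixed torsion)` (F4.e).
Both follow from the LEVEL CALCULUS on the minimal model `X` of `E` at `v` (Silverman VII.2.2 /
IV.3.2 / IV.6.4; tree `FormalGroupChart.val_zCoord_nsmul[_eq]`) with Kodaira–Néron at an ADDITIVE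
place (tree `exists_nsmul_reducesToNonsingular_le_four_of_hasAdditiveReduction`: ONE `c ≤ 4` with
`c·P ∈ E₀(X)` for every inertia-fixed `P`) and the cusp `E₀(X) → k̄⁺` (tree
`exists_addMonoidHom_residueField_of_cusp`, kernel `E₁`) whose target is killed by `p` as `v ∋ p`:
so `p·c·P ∈ E₁(X)` for every fixed `P` (`exists_transport_nsmul_mem_kernel`). `Φ`-free exports:

* `exists_nsmul_eq_zero_of_fixed_of_isOfFinAddOrder` — ONE `N > 0` kills every fixed TORSION point
  (`N = p²c`: `pcR ∈ E₁` is fixed so `|z(pcR)| ≤ |p|`; `p²cR ∈ E₂ = {|z| < |p|}`, torsion-free by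
  `|z(mQ)| = |m|·|z(Q)|`);
* `isOfFinAddOrder_of_forall_exists_fixed` — `R ∈ pⁿ·(fixed) + (fixed torsion)` for EVERY `n`
  forces `R` torsion (`|z(Φ(K·R))| ≤ |p|ⁿ` for all `n`, `|p| < 1`);
* `exists_fixed_not_isOfFinAddOrder` — a fixed point of INFINITE order (Hensel's point of `E₁(X)`
  with `z = p²`, tree `exists_mem_kernel_zCoord_eq`).

Hypotheses: `v ∋ p`, `W.HasAdditiveReductionAt v`; NO `p ≥ 5`, NO ordinarity, NO good model.

References: J. H. Silverman, *AEC* 2nd ed. VII.2.1, VII.2.2, VII.6.1, IV.3.2, IV.6.4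
[SilvermanAEC2009]; R. Greenberg, LNM 1716 (1999) §3 Lemma 3.4 [GreenbergLNM1716];
cells/n1011/skel/T-T3B.md (p12 GEN 8).
-/

set_option autoImplicit false

noncomputable section

open scoped Classical NNReal

open NumberField IsDedekindDomain Field IsDedekindDomain.HeightOneSpectrum WeierstrassCurve
open Literature.NumberTheory.EllipticCurves Literature.NumberTheory.GaloisRepresentations
  Literature.NumberTheory.EllipticCurves.FormalGroupChart
  Summit.BirchSwinnertonDyer.Rank1Residual.X2.GreenbergVatsalReductionDatum

namespace Summit.BirchSwinnertonDyer.Rank1Residual.Additive.FixedLevel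

variable (W : WeierstrassCurve ℚ) [W.IsElliptic] (p : ℕ) [hp : Fact p.Prime]
  {v : HeightOneSpectrum (𝓞 ℚ)}

/-! ### §3 The three `Φ`-free exports -/

/-- **ONE `N > 0` kills every `Γ_{ℚ_v}`-fixed torsion point of `E(K̄_v)`** at an additive `v ∋ p`
(`N = p²c`): `p c • R ∈ E₁(X)` (§1), `p² c • R ∈ E₂(X)` (§2), and `E₂(X)` has no torsion.
[cite: SilvermanAEC2009, Thm. VII.6.1, Prop. VII.2.1, VII.2.2, VII.3.1] -/
theorem exists_nsmul_eq_zero_of_fixed_of_isOfFinAddOrder (hpv : ((p : ℕ) : 𝓞 ℚ) ∈ v.asIdeal)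
    (hadd : W.HasAdditiveReductionAt v) :
    ∃ N : ℕ, 0 < N ∧ ∀ R : localPoints W (v.adicCompletion ℚ),
      (∀ σ : absoluteGaloisGroup (v.adicCompletion ℚ), σ • R = R) → IsOfFinAddOrder R → N • R = 0
          := by
  obtain ⟨X, hI, hE, Φ, N, hN, hΦ, hker⟩ := exists_transport_nsmul_mem_kernel W p hpv hadd
  haveI := hI
  have hw := specVal_spec v
  haveI : CharZero (AlgebraicClosure (v.adicCompletion ℚ)) := charZero_of_injective_algebraMap
      (algebraMap ℚ _).injective
  obtain ⟨hp0, hp1⟩ := val_p_pos_lt_one p hpv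
  refine ⟨p * N, Nat.mul_pos hp.out.pos hN, fun R hR hRtor ↦ ?_⟩
  -- `Q = Φ (N • R) ∈ E₁(X)` is fixed
  have hQ' : N • Φ R ∈ kernel (specVal v) (X.baseChange (AlgebraicClosure (v.adicCompletion ℚ)))
      := hker R hR
  have hQ : Φ (N • R) ∈ kernel (specVal v) (X.baseChange (AlgebraicClosure (v.adicCompletion ℚ)))
      := by
    rw [map_nsmul]; exact @hQ'
  obtain ⟨hpQ, hzle⟩ := nsmul_mem_kernel_and_val_zCoord_le_sq p hpv hQ
    (map_transport_nsmul_eq_of_fixed W Φ hΦ hR N)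
  have hzlt : specVal v (p • Φ (N • R)).zCoord < specVal v (p : (AlgebraicClosure
      (v.adicCompletion ℚ))) :=
    lt_of_le_of_lt hzle (by rw [sq]; exact mul_lt_of_lt_one_left hp0 hp1)
  -- the order of `R` kills `p • Q`, which is therefore `O`
  have hm := hRtor.addOrderOf_pos
  have hmQ : addOrderOf R • (p • Φ (N • R)) = 0 := by
    rw [← map_nsmul, ← map_nsmul, smul_comm (addOrderOf R) p (N • R), smul_comm (addOrderOf R) N R,
      addOrderOf_nsmul_eq_zero, smul_zero, smul_zero, map_zero]
  have h0 := eq_zero_of_nsmul_eq_zero_of_val_zCoord_lt p hpv hpQ hzlt hm hmQ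
  rw [← map_nsmul, ← mul_smul, Φ.map_eq_zero_iff] at h0
  exact h0

/-- **A point `pⁿ`-divisible modulo torsion by `Γ_{ℚ_v}`-fixed points for EVERY `n` is torsion**
(additive `v ∋ p`): with `K = N₁·p·N`, `K • R = pⁿ • (K • cₙ)` and `Φ(K • cₙ) ∈ E₂(X)`, so
`|z(Φ(K • R))| ≤ |p|ⁿ` for all `n`; `|p| < 1` forces `z = 0`, i.e. `K • R = 0` (the valuation form
of "`⋂ₙ (pⁿE(ℚ_v) + torsion) = torsion`"). [cite: SilvermanAEC2009, Prop. VII.2.2 and Prop. VII.6.3]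
[cite: GreenbergLNM1716, §3 Lemma 3.4 (p. 89)] -/
theorem isOfFinAddOrder_of_forall_exists_fixed (hpv : ((p : ℕ) : 𝓞 ℚ) ∈ v.asIdeal)
    (hadd : W.HasAdditiveReductionAt v) {R : localPoints W (v.adicCompletion ℚ)}
    (h : ∀ n : ℕ, ∃ c t : localPoints W (v.adicCompletion ℚ),
      (∀ σ : absoluteGaloisGroup (v.adicCompletion ℚ), σ • c = c) ∧
      (∀ σ : absoluteGaloisGroup (v.adicCompletion ℚ), σ • t = t) ∧ IsOfFinAddOrder t ∧ R = p ^ n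
          • c + t) :
    IsOfFinAddOrder R := by
  obtain ⟨X, hI, hE, Φ, N, hN, hΦ, hker⟩ := exists_transport_nsmul_mem_kernel W p hpv hadd
  haveI := hI
  obtain ⟨N₁, hN₁, htor⟩ := exists_nsmul_eq_zero_of_fixed_of_isOfFinAddOrder W p hpv hadd
  have hw := specVal_spec v
  haveI : CharZero (AlgebraicClosure (v.adicCompletion ℚ)) := charZero_of_injective_algebraMap
      (algebraMap ℚ _).injective
  obtain ⟨hp0, hp1⟩ := val_p_pos_lt_one p hpv
  have hunit : ∀ n : ℕ, ¬ p ∣ n → specVal v (n : (AlgebraicClosure (v.adicCompletion ℚ))) = 1 :=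
    fun n hn ↦ spectralValuation_natCast_eq_one_of_not_dvd hpv hw hn
  -- for a fixed `c`: `N₁ • p • Φ (N • c) ∈ E₁(X)` with `|z| ≤ |p|²`
  have step : ∀ c : localPoints W (v.adicCompletion ℚ),
      (∀ σ : absoluteGaloisGroup (v.adicCompletion ℚ), σ • c = c) →
      (N₁ • p • Φ (N • c)) ∈ kernel (specVal v) (X.baseChange (AlgebraicClosure (v.adicCompletion
          ℚ))) ∧
        specVal v (N₁ • p • Φ (N • c)).zCoord ≤ specVal v (p : (AlgebraicClosure (v.adicCompletion
            ℚ))) ^ 2 := by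
    intro c hc
    have hQ' : N • Φ c ∈ kernel (specVal v) (X.baseChange (AlgebraicClosure (v.adicCompletion ℚ)))
        := hker c hc
    have hQ : Φ (N • c) ∈ kernel (specVal v) (X.baseChange (AlgebraicClosure (v.adicCompletion
        ℚ))) := by
      rw [map_nsmul]; exact @hQ'
    obtain ⟨hpQ, hzle⟩ := nsmul_mem_kernel_and_val_zCoord_le_sq p hpv hQ
      (map_transport_nsmul_eq_of_fixed W Φ hΦ hc N)
    obtain ⟨hN₁Q, hzle', -⟩ := val_zCoord_nsmul (w := specVal v)
      (V := X.baseChange (AlgebraicClosure (v.adicCompletion ℚ))) N₁ hpQ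
    exact ⟨hN₁Q, hzle'.trans hzle⟩
  -- the point `S = Φ (K • R)` and its valuation bound for every `n`
  set S : (X.baseChange (AlgebraicClosure (v.adicCompletion ℚ))).toAffine.Point := Φ ((N₁ * (p *
      N)) • R) with hS
  have hSn : ∀ n : ℕ, S ∈ kernel (specVal v) (X.baseChange (AlgebraicClosure (v.adicCompletion
      ℚ))) ∧
      specVal v S.zCoord ≤ specVal v (p : (AlgebraicClosure (v.adicCompletion ℚ))) ^ n := by
    intro n
    obtain ⟨c, t, hc, ht, httor, hRct⟩ := h n
    obtain ⟨hmem, hz⟩ := step c hc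
    have hKt : (N₁ * (p * N)) • t = 0 := by
      rw [mul_comm, mul_smul, htor t ht httor, smul_zero]
    have hSe : S = p ^ n • (N₁ • p • Φ (N • c)) := by
      rw [hS, hRct, smul_add, hKt, add_zero, smul_comm (N₁ * (p * N)) (p ^ n) c, map_nsmul,
          mul_smul,
        mul_smul, map_nsmul, map_nsmul]
    have hpn : p ^ n ≠ 0 := pow_ne_zero n hp.out.ne_zero
    have hzlt : specVal v (N₁ • p • Φ (N • c)).zCoord < specVal v (p : (AlgebraicClosure
        (v.adicCompletion ℚ))) :=
      lt_of_le_of_lt hz (by rw [sq]; exact mul_lt_of_lt_one_left hp0 hp1)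
    have hval := val_zCoord_nsmul_eq (w := specVal v)
      (V := X.baseChange (AlgebraicClosure (v.adicCompletion ℚ))) hp.out hunit (p ^ n) hpn hmem hzlt
    have hmemS : p ^ n • (N₁ • p • Φ (N • c)) ∈ kernel (specVal v) (X.baseChange (AlgebraicClosure
        (v.adicCompletion ℚ))) :=
      (val_zCoord_nsmul (w := specVal v) (V := X.baseChange (AlgebraicClosure (v.adicCompletion ℚ)))
        (p ^ n) hmem).1
    refine ⟨by rw [hSe]; exact @hmemS, ?_⟩
    rw [hSe, hval, Nat.cast_pow, map_pow]
    calc specVal v (p : (AlgebraicClosure (v.adicCompletion ℚ))) ^ n *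
          specVal v (N₁ • p • Φ (N • c)).zCoord
        ≤ specVal v (p : (AlgebraicClosure (v.adicCompletion ℚ))) ^ n * 1 := mul_le_mul' le_rfl
            (hz.trans (pow_le_one₀ zero_le hp1.le))
      _ = specVal v (p : (AlgebraicClosure (v.adicCompletion ℚ))) ^ n := mul_one _
  -- hence `z(S) = 0`, `S = 0`, `K • R = 0`
  have hzS : specVal v S.zCoord = 0 := by
    by_contra hne
    have hpos : 0 < specVal v S.zCoord := pos_iff_ne_zero.mpr hne
    obtain ⟨n, hn⟩ := exists_pow_lt_of_lt_one hpos hp1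
    exact absurd (hSn n).2 (not_le.mpr hn)
  have hS0 : S = 0 :=
    (zCoord_eq_zero_iff (w := specVal v) (hSn 0).1).mp ((Valuation.zero_iff _).mp hzS)
  rw [hS, Φ.map_eq_zero_iff] at hS0
  exact isOfFinAddOrder_iff_nsmul_eq_zero.mpr
    ⟨N₁ * (p * N), Nat.mul_pos hN₁ (Nat.mul_pos hp.out.pos hN), hS0⟩

/-- **A `Γ_{ℚ_v}`-fixed point of `E(K̄_v)` of infinite order** at an additive `v ∋ p`: Hensel's point
of `E₁(X)` with `z = p²` (tree `exists_mem_kernel_zCoord_eq`) is fixed by every `|·|_v`-isometry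
fixing `p²`, and lies in the torsion-free `E₂(X)`. [cite: SilvermanAEC2009, Prop. VII.2.2] -/
theorem exists_fixed_not_isOfFinAddOrder (hpv : ((p : ℕ) : 𝓞 ℚ) ∈ v.asIdeal)
    (hadd : W.HasAdditiveReductionAt v) :
    ∃ u : localPoints W (v.adicCompletion ℚ),
      (∀ σ : absoluteGaloisGroup (v.adicCompletion ℚ), σ • u = u) ∧ ¬ IsOfFinAddOrder u := by
  obtain ⟨X, hI, hE, Φ, N, -, hΦ, -⟩ := exists_transport_nsmul_mem_kernel W p hpv hadd
  haveI := hI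
  haveI := hE
  have hw := specVal_spec v
  haveI : CharZero (AlgebraicClosure (v.adicCompletion ℚ)) := charZero_of_injective_algebraMap
      (algebraMap ℚ _).injective
  obtain ⟨hp0, hp1⟩ := val_p_pos_lt_one p hpv
  have hp2 : specVal v ((p : (AlgebraicClosure (v.adicCompletion ℚ))) ^ 2) < 1 := by
    rw [map_pow]; exact pow_lt_one₀ zero_le hp1 two_ne_zero
  obtain ⟨P, hPker, hPz, hPfix⟩ := exists_mem_kernel_zCoord_eq (w := specVal v) X hp2
  refine ⟨Φ.symm P, fun σ ↦ ?_, fun htor ↦ ?_⟩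
  · apply Φ.injective
    rw [hΦ σ, AddEquiv.apply_symm_apply]
    exact hPfix _ (fun z ↦ spectralValuation_smul hw σ z) (by rw [map_pow, map_natCast])
  · have hm := htor.addOrderOf_pos
    have hmP : addOrderOf (Φ.symm P) • P = 0 := by
      have h := congrArg Φ (addOrderOf_nsmul_eq_zero (Φ.symm P))
      rwa [map_nsmul, AddEquiv.apply_symm_apply, map_zero] at h
    have hzlt : specVal v P.zCoord < specVal v (p : (AlgebraicClosure (v.adicCompletion ℚ))) := by
      rw [hPz, map_pow, sq]; exact mul_lt_of_lt_one_left hp0 hp1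
    have hP0 := eq_zero_of_nsmul_eq_zero_of_val_zCoord_lt p hpv hPker hzlt hm hmP
    have hz0 : P.zCoord = 0 := by rw [hP0, WeierstrassCurve.Affine.Point.zCoord_zero]
    rw [hPz] at hz0
    exact pow_ne_zero 2 (Nat.cast_ne_zero.mpr hp.out.ne_zero) hz0

end Summit.BirchSwinnertonDyer.Rank1Residual.Additive.FixedLevel

end
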